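import Literature.AlgebraicGeometry.Motives.HodgeLieWeightOneLeviSpanBracket
import Literature.AlgebraicGeometry.Motives.HodgeLieWeightOneRankOneJordan
import HarnessLib

/-!
# Weight one, `End_Hdg = ℚ`, `𝔥_ℂ` simple, `2 · rank B > dim V^{1,0} > rank B`: the raising space is NOT spanned by the minimal
# tripotent `B` and a single Peirce-`1` element (the plane `(E y)(V_ℂ)` would be Levi-stable; Moonen–Zarhin 1999 (2.3))

Family `hodge`, layer `Literature/AlgebraicGeometry/Motives`; THEOREMS ONLY (no definition, no named fact; D-0026).  Written for the
cell `pub-hodgeav-hg6` (LADDER-HodgeAV row 2, TABLE X row 1 `g6.I(1)`: brick N16 of the row-1 programme — the sub-case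
`dim 𝔥⁺ = 2` of the residual `r = 4` crux; honest framing: HC / HC_AV / HC_CM NOT proved — unconditional Hodge–Lie linear algebra).

* **`false_of_raising_subset_span_pair`** — `H` effective polarized of weight `1`, `End_Hdg = ℚ`, `𝔥_ℂ` simple; `B ∈ 𝔥_ℂ` a minimal
  raising tripotent (`B B̄ B = t B`) with `rank B < dim V^{1,0} < 2 · rank B`; `y ∈ 𝔥_ℂ` a non-zero Peirce-`1` raising element
  (`E y + y F = y`, `E y F = 0`, `E = t⁻¹ B B̄`, `F = t⁻¹ B̄ B`) such that EVERY raising element of `𝔥_ℂ` lies in `ℂ B + ℂ y`.  Then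
  `False`.  PROOF: by N15 (`levi_mem_span_bracket_of_simple`) every Levi element of `𝔥_ℂ` is a combination of
  `[B, B̄], [B, ȳ], [y, B̄], [y, ȳ]`; each maps the subspace `M = (E y)(V_ℂ) ⊆ range B` into itself (`[B, B̄]` acts on `M` by `t`,
  `[B, ȳ]` and `[y, B̄]` kill `M` — the latter by `y B̄ y = 0`, N14 —, and `[y, ȳ] M ⊆ (E y)(ker F) ⊆ M`); `M ≠ 0` (`E y ≠ 0`, as
  `E y` and `y F` are `ψ_ℂ`-transposes) and `M ⊆ range B ≠ V^{1,0}`, contradicting the orbit lemma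
  `SymplecticThetaSix.eq_bot_or_eq_of_stable_le` (irreducibility of `V_ℂ` for `End_Hdg = ℚ`).

## References

* [MoonenZarhin1999LowDim] B. Moonen, Yu. Zarhin, *Hodge classes on abelian varieties of low dimension*, Math. Ann. 315 (1999),
  §2 (2.3)–(2.5).
* [Deligne1982HodgeCycles] P. Deligne, *Hodge cycles on abelian varieties*, LNM 900 (1982), I §3 (Prop. 3.4, 3.6).
-/

noncomputable section

open scoped TensorProduct

namespace Literature.AlgebraicGeometry.Motives

namespace HodgeStructure

universe u

variable {V : Type u} [AddCommGroup V] [Module ℚ V] [Module.Finite ℚ V] [HodgeTensorFacts.{u, u}] {n : ℤ}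

set_option maxHeartbeats 3200000 in
/-- **The raising space of a simple `𝔥_ℂ` is not `ℂ B + ℂ y`** for a minimal tripotent `B` with `rank B < dim V^{1,0} < 2 rank B` and a
Peirce-`1` element `y`. [cite: MoonenZarhin1999LowDim, §2 (2.3)–(2.5)] [cite: Deligne1982HodgeCycles, I §3 Prop. 3.4, Prop. 3.6] -/
theorem false_of_raising_subset_span_pair (H : HodgeStructure V n) (ψ : H.Polarization) (hn : n = 1) (heff : H.IsEffective)
    (hE : ∀ a ∈ H.endAlg, ∃ x : ℚ, a = x • (1 : Module.End ℚ V))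
    (hsimple : ∀ T : Submodule ℂ (Module.End ℂ (ℂ ⊗[ℚ] V)), T ≤ H.hodgeLieC → T ≠ ⊥ →
      (∀ Y ∈ H.hodgeLieC, ∀ t ∈ T, Y * t - t * Y ∈ T) → T = H.hodgeLieC)
    {B C : Module.End ℂ (ℂ ⊗[ℚ] V)} (hB : B ∈ H.hodgeLieC) (hB0 : B ≠ 0) (hBP : ∀ p ∈ H.piece 1 0, B p = 0)
    (hBim : ∀ v, B v ∈ H.piece 1 0) (hC : ∀ v, C v = conj (B (conj v)))
    (hmin : ∀ B' ∈ H.hodgeLieC, B' ≠ 0 → (∀ p ∈ H.piece 1 0, B' p = 0) → (∀ v, B' v ∈ H.piece 1 0) →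
      Module.finrank ℂ (LinearMap.range B) ≤ Module.finrank ℂ (LinearMap.range B'))
    {t : ℂ} (ht : t ≠ 0) (hBCB : B * C * B = t • B)
    (h2r : Module.finrank ℂ (H.piece 1 0) < 2 * Module.finrank ℂ (LinearMap.range B))
    (hrg : Module.finrank ℂ (LinearMap.range B) < Module.finrank ℂ (H.piece 1 0))
    {y yb : Module.End ℂ (ℂ ⊗[ℚ] V)} (hy : y ∈ H.hodgeLieC) (hy0 : y ≠ 0) (hyP : ∀ p ∈ H.piece 1 0, y p = 0)
    (hyim : ∀ v, y v ∈ H.piece 1 0) (hy1 : t⁻¹ • (B * C) * y + y * (t⁻¹ • (C * B)) = y)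
    (hEyF : t⁻¹ • (B * C) * y * (t⁻¹ • (C * B)) = 0) (hyb : ∀ v, yb v = conj (y (conj v)))
    (hpair : ∀ x ∈ H.hodgeLieC, (∀ p ∈ H.piece 1 0, x p = 0) → (∀ v, x v ∈ H.piece 1 0) → ∃ c₁ c₂ : ℂ, x = c₁ • B + c₂ • y) :
    False := by
  classical
  obtain ⟨hbr, hskew, -, Θ, hΘ, hΘ𝔤⟩ := hodgeLie_standing H ψ
  have hspan : H.hodgeLieC = spanC H.hodgeLie := hodgeLieC_eq_spanC H
  have hΘC : Θ ∈ H.hodgeLieC := by rw [hspan]; exact hΘ𝔤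
  have hbrC : ∀ Y ∈ H.hodgeLieC, ∀ Y' ∈ H.hodgeLieC, Y * Y' - Y' * Y ∈ H.hodgeLieC := fun Y hY Y' hY' => by
    rw [hspan] at hY hY' ⊢
    exact commutator_mem_spanC hbr hY hY'
  have hconj : ∀ Z ∈ H.hodgeLieC, ∀ Z' : Module.End ℂ (ℂ ⊗[ℚ] V), (∀ v, Z' v = conj (Z (conj v))) → Z' ∈ H.hodgeLieC :=
    fun Z hZ Z' hZ' => by
      rw [hspan] at hZ ⊢
      exact conjOp_mem_spanC hZ hZ'
  have hirr : ∀ U : Submodule ℂ (ℂ ⊗[ℚ] V), (∀ Z ∈ H.hodgeLieC, ∀ u ∈ U, Z u ∈ U) → U = ⊥ ∨ U = ⊤ :=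
    fun U hU => SymplecticTheta.eq_bot_or_top_of_stable H hn heff ψ hE H.hodgeLie hΘ hΘ𝔤 hskew
      fun X hX u hu => hU _ (by rw [hspan]; exact baseChange_mem_spanC hX) u hu
  have hC𝔊 : C ∈ H.hodgeLieC := hconj B hB C hC
  have hyb𝔊 : yb ∈ H.hodgeLieC := hconj y hy yb hyb
  have hyCy := WeightOnePeirce.mul_conjOp_mul_eq_zero_of_peirceOne H ψ hn heff hΘ le_rfl hbrC hB hB0 hBP hBim hC hC𝔊 hmin ht
    hBCB h2r hy hyP hyim hEyF
  obtain ⟨hCBC, htreal⟩ := WeightOnePeirce.conjOp_mul_conjOp_mul hC ht hB0 hBCB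
  subst hn
  obtain ⟨hPmem, hQmem, hΘ10, hΘ01, hΘΘ⟩ := UnitaryTheta.theta_facts H rfl heff hΘ
  set P := H.piece 1 0 with hPdef
  set Q := H.piece 0 1 with hQdef
  set M := ℂ ⊗[ℚ] V
  obtain ⟨hCQ, hCim, hcC, hcB⟩ := SymplecticThetaTen.conjOp_raise (P := P) (Q := Q)
    (fun x hx => conj_mem_piece H hx) (fun x hx => conj_mem_piece H hx) hBP hBim hC
  obtain ⟨hybQ, hybim, hcyb, hcy⟩ := SymplecticThetaTen.conjOp_raise (P := P) (Q := Q)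
    (fun x hx => conj_mem_piece H hx) (fun x hx => conj_mem_piece H hx) hyP hyim hyb
  have hBB : B * B = 0 := LinearMap.ext fun v => by
    rw [Module.End.mul_apply, hBP _ (hBim v), LinearMap.zero_apply]
  have hCC : C * C = 0 := LinearMap.ext fun v => by
    rw [Module.End.mul_apply, hCQ _ (hCim v), LinearMap.zero_apply]
  obtain ⟨E, hEdef⟩ : ∃ E : Module.End ℂ M, E = t⁻¹ • (B * C) := ⟨_, rfl⟩
  obtain ⟨F, hFdef⟩ : ∃ F : Module.End ℂ M, F = t⁻¹ • (C * B) := ⟨_, rfl⟩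
  rw [← hEdef, ← hFdef] at hy1 hEyF
  obtain ⟨hEE, hFF, hEB, hBF, hFC, hCE, hBE, hFB, hEF, hFE⟩ := WeightOnePeirce.tripotent_facts ht hBCB hCBC hBB hCC hEdef hFdef
  have hEP : ∀ v, E v ∈ P := fun v => by
    rw [hEdef, LinearMap.smul_apply, Module.End.mul_apply]
    exact Submodule.smul_mem _ _ (hBim _)
  have hEQ : ∀ q ∈ Q, E q = 0 := fun q hq => by
    rw [hEdef, LinearMap.smul_apply, Module.End.mul_apply, hCQ q hq, map_zero, smul_zero]
  have hFP : ∀ p ∈ P, F p = 0 := fun p hp => by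
    rw [hFdef, LinearMap.smul_apply, Module.End.mul_apply, hBP p hp, map_zero, smul_zero]
  have hrangeE : LinearMap.range E = LinearMap.range B :=
    (WeightOneMinimalRaising.isIdempotentElem_of_mul_conjOp_mul_eq_smul H rfl heff hΘ hBP hBim hC ht hBCB).2.1 |> fun h => by
      rw [hEdef]; exact h
  -- conjugation exchanges `E` and `F`
  have hconjF : ∀ w, conj (F w) = E (conj w) := fun w => by
    rw [hFdef, hEdef, LinearMap.smul_apply, LinearMap.smul_apply, Module.End.mul_apply, Module.End.mul_apply, conj_smul,
      map_inv₀, htreal, hcC, hcB]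
  have hconjE : ∀ w, conj (E w) = F (conj w) := fun w => by
    have h := hconjF (conj w)
    rw [conj_conj] at h
    rw [← h, conj_conj]
  -- the form and `E y ≠ 0`
  set ω := ψ.form.baseChange ℂ with hω
  have hωalt : ∀ x x', ω x x' = -ω x' x := fun x x' => by rw [hω, form_baseChange_swap_of_odd H odd_one ψ x' x]
  have hωnd : ω.Nondegenerate := by rw [hω]; exact ψ.nondegenerate_baseChange
  have hBsk : ∀ x x', ω (B x) x' = -ω x (B x') := fun x x' => by rw [hω, formBaseChange_skew_of_mem_hodgeLieC ψ hB]
  have hCsk : ∀ x x', ω (C x) x' = -ω x (C x') := fun x x' => by rw [hω, formBaseChange_skew_of_mem_hodgeLieC ψ hC𝔊]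
  have hysk : ∀ x x', ω (y x) x' = -ω x (y x') := fun x x' => by rw [hω, formBaseChange_skew_of_mem_hodgeLieC ψ hy]
  have hysymm : ∀ x x', ω (y x) x' = ω (y x') x := fun x x' => by rw [hysk, hωalt x, neg_neg]
  have hEFadj : ∀ x x', ω (E x) x' = ω x (F x') := fun x x' => by
    rw [hEdef, hFdef, LinearMap.smul_apply, LinearMap.smul_apply, Module.End.mul_apply, Module.End.mul_apply, map_smul,
      LinearMap.smul_apply, map_smul, smul_eq_mul, smul_eq_mul, hBsk, hCsk, neg_neg]
  have hEy0 : E * y ≠ 0 := by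
    intro h0
    -- then `y F = 0` by transposition, so `y = 0`
    have hyF0 : y * F = 0 := LinearMap.ext fun x' => hωnd.1 _ fun x => by
      rw [Module.End.mul_apply, hysymm (F x') x, ← hEFadj, ← Module.End.mul_apply E y x, h0,
        LinearMap.zero_apply, map_zero, LinearMap.zero_apply]
    apply hy0
    rw [← hy1, h0, hyF0, add_zero]
  -- the invariant subspace `M = range (E y)`
  set Mspace : Submodule ℂ M := LinearMap.range (E * y) with hMdef
  have hMP : Mspace ≤ P := by
    rintro _ ⟨v, rfl⟩
    exact hEP _
  have hMU : Mspace ≤ LinearMap.range B := by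
    rintro _ ⟨v, rfl⟩
    rw [← hrangeE]
    exact LinearMap.mem_range_self E _
  have hMne : Mspace ≠ ⊥ := fun h => hEy0 (LinearMap.range_eq_bot.1 h)
  have hMneP : Mspace ≠ P := fun h => by
    have h1 := Submodule.finrank_mono hMU
    rw [h] at h1
    exact (not_lt.2 h1) hrg
  -- the four brackets preserve `M`
  have hEM : ∀ m ∈ Mspace, E m = m := by
    rintro _ ⟨v, rfl⟩
    rw [← Module.End.mul_apply, ← mul_assoc, hEE]
  have hL0 : ∀ m ∈ Mspace, (B * C - C * B) m ∈ Mspace := fun m hm => by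
    have hmP : m ∈ P := hMP hm
    rw [LinearMap.sub_apply, Module.End.mul_apply, Module.End.mul_apply, hBP m hmP, map_zero, sub_zero,
      show B (C m) = (B * C) m from rfl, show B * C = t • E by rw [hEdef, smul_smul, mul_inv_cancel₀ ht, one_smul],
      LinearMap.smul_apply, hEM m hm]
    exact Submodule.smul_mem _ _ hm
  -- pointwise facts on `M`
  have hMfacts : ∀ m ∈ Mspace, m ∈ P ∧ E m = m ∧ B m = 0 ∧ y m = 0 := fun m hm =>
    ⟨hMP hm, hEM m hm, hBP m (hMP hm), hyP m (hMP hm)⟩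
  have hyE : ∀ x, F x = 0 → y x = E (y x) := fun x hx => by
    have h := LinearMap.congr_fun hy1 x
    rw [LinearMap.add_apply, Module.End.mul_apply, Module.End.mul_apply, hx, map_zero, add_zero] at h
    exact h.symm
  have hybM : ∀ m ∈ Mspace, yb m ∈ Q ∧ F (yb m) = 0 := fun m hm => by
    obtain ⟨hmP, hEm, -, -⟩ := hMfacts m hm
    refine ⟨hybim m, ?_⟩
    -- `F (ȳ m) = conj (E (y (conj m)))` and `conj m = F (conj m)` since `E m = m`
    have h1 : conj m = F (conj m) := by rw [← hconjE, hEm]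
    rw [hyb, ← hconjE, h1, ← Module.End.mul_apply, ← Module.End.mul_apply, show E * y * F = 0 from hEyF,
      LinearMap.zero_apply, map_zero]
  have hyCEy : y * C * (E * y) = 0 := by
    have hEy : E * y = y - y * F := eq_sub_of_add_eq hy1
    rw [hEy, mul_sub, hyCy, zero_sub, neg_eq_zero, ← mul_assoc, hyCy, zero_mul]
  have hL1 : ∀ m ∈ Mspace, (B * yb - yb * B) m ∈ Mspace := fun m hm => by
    obtain ⟨-, -, hBm, -⟩ := hMfacts m hm
    obtain ⟨-, hFm⟩ := hybM m hm
    rw [LinearMap.sub_apply, Module.End.mul_apply, Module.End.mul_apply, hBm, map_zero, sub_zero, ← hBF,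
      Module.End.mul_apply, hFm, map_zero]
    exact Submodule.zero_mem _
  have hL2 : ∀ m ∈ Mspace, (y * C - C * y) m ∈ Mspace := fun m hm => by
    obtain ⟨-, -, -, hym⟩ := hMfacts m hm
    obtain ⟨v, rfl⟩ := hm
    have e2 : y (C ((E * y) v)) = 0 := by
      have h := LinearMap.congr_fun hyCEy v
      simpa only [Module.End.mul_apply, LinearMap.zero_apply] using h
    have e : (y * C - C * y) ((E * y) v) = 0 := by
      simp only [LinearMap.sub_apply, Module.End.mul_apply] at hym e2 ⊢
      rw [hym, e2, map_zero, sub_zero]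
    rw [e]
    exact Submodule.zero_mem _
  have hL3 : ∀ m ∈ Mspace, (y * yb - yb * y) m ∈ Mspace := fun m hm => by
    obtain ⟨-, -, -, hym⟩ := hMfacts m hm
    obtain ⟨-, hFm⟩ := hybM m hm
    rw [LinearMap.sub_apply, Module.End.mul_apply, Module.End.mul_apply, hym, map_zero, sub_zero, hyE _ hFm]
    exact ⟨yb m, rfl⟩
  -- lowering elements are combinations of `C` and `ȳ`
  have hpair' : ∀ z ∈ H.hodgeLieC, (∀ q ∈ Q, z q = 0) → (∀ v, z v ∈ Q) → ∃ d₁ d₂ : ℂ, z = d₁ • C + d₂ • yb := by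
    intro z hz hzQ hzim
    obtain ⟨zb, hzb⟩ := exists_conjOp z
    have hzb𝔊 : zb ∈ H.hodgeLieC := hconj z hz zb hzb
    have hzbP : ∀ p ∈ P, zb p = 0 := fun p hp => by rw [hzb, hzQ _ (conj_mem_piece H hp), map_zero]
    have hzbim : ∀ v, zb v ∈ P := fun v => by rw [hzb]; exact conj_mem_piece H (hzim _)
    obtain ⟨c₁, c₂, hzbeq⟩ := hpair zb hzb𝔊 hzbP hzbim
    refine ⟨starRingEnd ℂ c₁, starRingEnd ℂ c₂, LinearMap.ext fun v => ?_⟩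
    have h : z v = conj (zb (conj v)) := by rw [hzb, conj_conj, conj_conj]
    rw [h, hzbeq, LinearMap.add_apply, LinearMap.smul_apply, LinearMap.smul_apply, map_add, conj_smul, conj_smul, hcB, hcy,
      conj_conj, LinearMap.add_apply, LinearMap.smul_apply, LinearMap.smul_apply]
  -- every bracket `[x, z]` of a raising and a lowering element preserves `M`
  have hGM : ∀ x ∈ H.hodgeLieC, ∀ z ∈ H.hodgeLieC, (∀ p ∈ P, x p = 0) → (∀ v, x v ∈ P) → (∀ q ∈ Q, z q = 0) →
      (∀ v, z v ∈ Q) → ∀ m ∈ Mspace, (x * z - z * x) m ∈ Mspace := by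
    intro x hx z hz hxP hxim hzQ hzim m hm
    obtain ⟨c₁, c₂, rfl⟩ := hpair x hx hxP hxim
    obtain ⟨d₁, d₂, rfl⟩ := hpair' z hz hzQ hzim
    have e : ((c₁ • B + c₂ • y) * (d₁ • C + d₂ • yb) - (d₁ • C + d₂ • yb) * (c₁ • B + c₂ • y)) m =
        (c₁ * d₁) • (B * C - C * B) m + (c₁ * d₂) • (B * yb - yb * B) m + (c₂ * d₁) • (y * C - C * y) m +
          (c₂ * d₂) • (y * yb - yb * y) m := by
      simp only [LinearMap.sub_apply, LinearMap.add_apply, LinearMap.smul_apply, Module.End.mul_apply, map_add, map_smul,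
        smul_sub, smul_add, smul_smul, mul_comm d₁ c₁, mul_comm d₂ c₁, mul_comm d₁ c₂, mul_comm d₂ c₂]
      abel
    rw [e]
    exact Submodule.add_mem _ (Submodule.add_mem _ (Submodule.add_mem _ (Submodule.smul_mem _ _ (hL0 m hm))
      (Submodule.smul_mem _ _ (hL1 m hm))) (Submodule.smul_mem _ _ (hL2 m hm))) (Submodule.smul_mem _ _ (hL3 m hm))
  -- hence every Levi element of `𝔥_ℂ` preserves `M` (N15)
  have hLeviM : ∀ Z ∈ H.hodgeLieC, (∀ p ∈ P, Z p ∈ P) → (∀ q ∈ Q, Z q ∈ Q) → ∀ m ∈ Mspace, Z m ∈ Mspace := by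
    intro Z hZ hZP hZQ m hm
    have hZspan := levi_mem_span_bracket_of_simple H ψ rfl heff hsimple hB hB0 hBP hBim hZ hZP hZQ
    refine Submodule.span_induction (p := fun W _ => W m ∈ Mspace) (fun W hW => ?_) ?_ (fun W W' _ _ h h' => ?_)
      (fun c W _ h => ?_) hZspan
    · obtain ⟨x, hx, z, hz, hxP, hxim, hzQ, hzim, rfl⟩ := hW
      exact hGM x hx z hz hxP hxim hzQ hzim m hm
    · rw [LinearMap.zero_apply]; exact Submodule.zero_mem _
    · rw [LinearMap.add_apply]; exact Submodule.add_mem _ h h'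
    · rw [LinearMap.smul_apply]; exact Submodule.smul_mem _ _ h
  -- the orbit lemma
  have hU : ∀ Z ∈ H.hodgeLieC, (∀ p ∈ P, Z p ∈ P) → ∀ m ∈ Mspace, Z m ∈ Mspace := by
    intro Z hZ hZP m hm
    obtain ⟨Zm, hZm, Z0, hZ0, Zp, hZp, hZsum, hZpP, -, -, hZmim, -, -, hZ0P, hZ0Q⟩ :=
      SymplecticTheta.exists_decomp H.hodgeLieC hbrC hΘC hΘΘ hΘ10 hΘ01 hPmem hQmem hZ
    have hmP : m ∈ P := hMP hm
    have hPQ0 : ∀ x, x ∈ P → x ∈ Q → x = 0 := fun x hP' hQ' => by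
      have h1 := hΘ10 x hP'
      rw [hΘ01 x hQ', neg_eq_iff_add_eq_zero, ← two_smul ℂ x, smul_eq_zero] at h1
      exact h1.resolve_left (two_ne_zero' ℂ)
    have hZmm : Zm m = 0 := by
      refine hPQ0 _ ?_ (hZmim m)
      have h : Zm m = Z m - Z0 m - Zp m := by rw [hZsum, LinearMap.add_apply, LinearMap.add_apply]; abel
      rw [h, hZpP m hmP, sub_zero]
      exact Submodule.sub_mem _ (hZP m hmP) (hZ0P m hmP)
    rw [hZsum, LinearMap.add_apply, LinearMap.add_apply, hZmm, zero_add, hZpP m hmP, add_zero]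
    exact hLeviM Z0 hZ0 hZ0P hZ0Q m hm
  rcases SymplecticThetaSix.eq_bot_or_eq_of_stable_le H.hodgeLieC hbrC hΘC hΘΘ hΘ10 hΘ01 hPmem hQmem hirr Mspace hMP hU
    with h | h
  · exact hMne h
  · exact hMneP h

end HodgeStructure

end Literature.AlgebraicGeometry.Motives
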